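import Mathlib
import Summits.ResolutionOfSingularities.ResolutionOfSingularities.Theorems.HomologicalConductorNoZenoFullSheafHartogs
import Summits.ResolutionOfSingularities.ResolutionOfSingularities.Theorems.HomologicalConductorNoZenoReflexiveHullLocalization
import HarnessLib

/-!
# Full sheaves: a vector of the reflexive hull of a stalk lattice is a section on a punctured
# neighbourhood (G2 (iv) input, chain W4.4)

`[OURS · L W4.4]` Crux `HomologicalConductor.NoZenoR` (stmt-ResolutionOfSingularities-19943; twin `NoZeno`
stmt-16483), line `sandwich-cluster`, S3 Layer 2, G-layer item **G2 (iv) «the full sheaf `M̃ = 𝒪_X · S` is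
locally free»** (holder's cut 2026-08-27T06:00:41Z: this seat), over res-D-pv-045 AS res-L0-w44-stub-8's
OBJECT `FullSheaf.generatedSheaf V S` (p500643) and its stalk lattices `stalkSpan V S x = 𝒪_{X,x} · S`.
Second step of the route «`M̃^{∨∨}/M̃` is supported at closed points; `Ȟ⁰ ↪ Ȟ¹(M̃) = 0`»:

* `exists_opens_forall_mem_stalkSpan` — **the locus `{x | v ∈ 𝒪_{X,x} · S}` is open**: a vector of one
  stalk lattice lies in the stalk lattices of a neighbourhood (the germs in a linear combination are
  sections near `x`);
* `exists_pow_maximalIdeal_smul_mem` — over a noetherian local ring, if `h` has a multiple `u • h ∈ N`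
  with `u ∉ 𝔮` for every prime `𝔮 ≠ 𝔪` (e.g. `h` in the reflexive hull of `N` over a regular local ring
  of dimension `≤ 2`, `exists_smul_mem_of_mem_reflexiveHull_of_ne_maximalIdeal`, p503663), then
  `𝔪^k • h ⊆ N` for some `k`;
* **`exists_opens_forall_ne_mem_stalkSpan`** — for a CLOSED point `y₀` of the locally noetherian integral
  `X` whose local ring is regular of dimension `≤ 2`, and `h` in the reflexive hull of the finitely
  generated stalk lattice `𝒪_{X,y₀} · S`: there is an open `U₀ ∋ y₀` with `h ∈ 𝒪_{X,x} · S` for every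
  `x ∈ U₀ ∖ {y₀}` («`h` is a section of `M̃` on a punctured neighbourhood of `y₀`»): in an affine chart the
  maximal ideal `𝔭₀` of `y₀` has generators `aᵢ`, `aᵢ^k • h` lies in the lattices near `y₀`, and at
  `x ≠ y₀` some `aᵢ` is a unit.

Replaces the role of no printed item of the manuscript under review (Hironaka 2017); AI-written, weaker
than expert review. [cite: ArtinVerdier1985, Lemma (1.1) (ii)]; [cite: BrunsHerzog1998, Prop. 1.4.1]
-/

-- single-problem summit: the doubled namespace component `ResolutionOfSingularities` is forced
set_option linter.dupNamespace false

noncomputable section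

open CategoryTheory AlgebraicGeometry TopologicalSpace Opposite
open Literature.AlgebraicGeometry.Resolution Literature.AlgebraicGeometry.Motives

namespace Summit.ResolutionOfSingularities.ResolutionOfSingularities.Theorems.NoZeno.SandwichCluster.FullSheaf

variable {X : Scheme.{0}} [IsIntegral X]
variable (V : Type) [AddCommGroup V] [Module X.functionField V] (S : Set V)

/-! ## Germs act through their sections; the lattice locus is open -/

/-- The germ of a section acts on `V` through the value of the section in `K(X)` (independent of the
point of the open at which the germ is taken). [folklore] -/
theorem germ_smul_eq_evalFn_smul {W : X.Opens} (x : W) (g : Γ(X, W)) (v : V) :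
    (letI := stalkModule V x.1; X.presheaf.germ W x.1 x.2 g • v) = evalFn W x g • v := by
  letI := stalkModule V x.1
  rw [stalk_smul_def, evalFn_apply]

/-- **The lattice locus is open**: if `v ∈ 𝒪_{X,x} · S` then `v ∈ 𝒪_{X,x'} · S` for all `x'` in an open
neighbourhood of `x` (write `v = Σ tᵢ • sᵢ`; the germs `tᵢ` are sections near `x`, and a section acts
through its point-independent value in `K(X)`). [folklore] -/
theorem exists_opens_forall_mem_stalkSpan (x : X) {v : V} (hv : v ∈ stalkSpan V S x) :
    ∃ W : X.Opens, x ∈ W ∧ ∀ x' : X, x' ∈ W → v ∈ stalkSpan V S x' := by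
  letI := stalkModule V x
  induction hv using Submodule.span_induction with
  | mem w hw => exact ⟨⊤, trivial, fun x' _ => subset_stalkSpan V S x' hw⟩
  | zero => exact ⟨⊤, trivial, fun x' _ => (stalkSpan V S x').zero_mem⟩
  | add w w' _ _ hw hw' =>
    obtain ⟨W, hxW, hW⟩ := hw
    obtain ⟨W', hxW', hW'⟩ := hw'
    exact ⟨W ⊓ W', ⟨hxW, hxW'⟩, fun x' hx' => (stalkSpan V S x').add_mem (hW x' hx'.1) (hW' x' hx'.2)⟩
  | smul t w _ hw =>
    obtain ⟨W, hxW, hW⟩ := hw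
    obtain ⟨W', hxW', g, hg⟩ := TopCat.Presheaf.exists_germ_eq X.presheaf t
    refine ⟨W ⊓ W', ⟨hxW, hxW'⟩, fun x' hx' => ?_⟩
    letI := stalkModule V x'
    have h1 : (t • w : V) = evalFn W' ⟨x, hxW'⟩ g • w := by
      rw [← hg]; exact germ_smul_eq_evalFn_smul V ⟨x, hxW'⟩ g w
    rw [h1, evalFn_eq_evalFn W' ⟨x, hxW'⟩ ⟨x', hx'.2⟩, ← germ_smul_eq_evalFn_smul V ⟨x', hx'.2⟩ g w]
    exact (stalkSpan V S x').smul_mem _ (hW x' hx'.1)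

/-! ## A power of the maximal ideal conducts the hull into the lattice -/

/-- Over a noetherian local ring `R`: if for every prime `𝔮 ≠ 𝔪` some `u ∉ 𝔮` has `u • h ∈ N`, then
`𝔪^k • h ⊆ N` for some `k` (the conductor ideal of `h` into `N` lies in no prime except possibly `𝔪`,
so its radical contains `𝔪`). [folklore] -/
theorem exists_pow_maximalIdeal_smul_mem {R : Type*} [CommRing R] [IsNoetherianRing R] [IsLocalRing R]
    {W : Type*} [AddCommGroup W] [Module R W] (N : Submodule R W) (h : W)
    (hN : ∀ 𝔮 : Ideal R, 𝔮.IsPrime → 𝔮 ≠ IsLocalRing.maximalIdeal R → ∃ u ∉ 𝔮, u • h ∈ N) :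
    ∃ k : ℕ, ∀ g ∈ IsLocalRing.maximalIdeal R ^ k, g • h ∈ N := by
  classical
  let J : Ideal R := N.comap (LinearMap.toSpanSingleton R W h)
  have hJ : ∀ g : R, g ∈ J ↔ g • h ∈ N := fun g => by
    simp [J, LinearMap.toSpanSingleton_apply]
  -- `𝔪 ≤ √J`: every prime containing `J` is `𝔪`
  have hrad : IsLocalRing.maximalIdeal R ≤ J.radical := by
    rw [Ideal.radical_eq_sInf]
    refine le_sInf fun 𝔮 h𝔮 => ?_
    obtain ⟨hJ𝔮, h𝔮p⟩ := h𝔮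
    by_cases heq : 𝔮 = IsLocalRing.maximalIdeal R
    · exact heq ▸ le_rfl
    · obtain ⟨u, hu𝔮, hu⟩ := hN 𝔮 h𝔮p heq
      exact absurd (hJ𝔮 ((hJ u).2 hu)) hu𝔮
  obtain ⟨k, hk⟩ := Ideal.exists_pow_le_of_le_radical_of_fg hrad (IsNoetherian.noetherian _)
  exact ⟨k, fun g hg => (hJ g).1 (hk hg)⟩

/-! ## The punctured neighbourhood -/

/-- The stalk lattice is an `𝒪_{X,y}`-module closed under the inverse of a unit germ: if `u` is a unit of
`𝒪_{X,y}` and `u • h ∈ 𝒪_{X,y} · S` then `h ∈ 𝒪_{X,y} · S`. [folklore] -/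
theorem mem_stalkSpan_of_isUnit_smul_mem (y : X) {u : X.presheaf.stalk y} (hu : IsUnit u) {h : V}
    (hh : (letI := stalkModule V y; u • h) ∈ stalkSpan V S y) : h ∈ stalkSpan V S y := by
  letI := stalkModule V y
  have : h = (↑hu.unit⁻¹ : X.presheaf.stalk y) • (u • h) := by
    rw [smul_smul, IsUnit.val_inv_mul, one_smul]
  rw [this]
  exact (stalkSpan V S y).smul_mem _ hh

/-- **A vector of the reflexive hull of the stalk lattice at a closed point is a section of `𝒪_X · S` on
a punctured neighbourhood.**  `X` integral and locally noetherian, `y₀` a CLOSED point whose local ring is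
regular of Krull dimension `≤ 2`, the stalk lattice `𝒪_{X,y₀} · S` finitely generated, and `h` in its
reflexive hull: then `h ∈ 𝒪_{X,x} · S` for every `x ≠ y₀` in some open `U₀ ∋ y₀`.
[cite: ArtinVerdier1985, Lemma (1.1) (ii)]; [cite: BrunsHerzog1998, Prop. 1.4.1] -/
theorem exists_opens_forall_ne_mem_stalkSpan [IsLocallyNoetherian X] (y₀ : X)
    (hy₀ : IsClosed ({y₀} : Set X)) [IsRegularLocalRing (X.presheaf.stalk y₀)]
    (hdim : ringKrullDim (X.presheaf.stalk y₀) ≤ 2)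
    (hfin : (letI := stalkModule V y₀; Module.Finite (X.presheaf.stalk y₀) (stalkSpan V S y₀)))
    {h : V} (hh : (letI := stalkModule V y₀; h ∈ reflexiveHull (stalkSpan V S y₀))) :
    ∃ U₀ : X.Opens, y₀ ∈ U₀ ∧ ∀ x : X, x ∈ U₀ → x ≠ y₀ → h ∈ stalkSpan V S x := by
  classical
  letI := stalkModule V y₀
  haveI := hfin
  haveI : NoZeroSMulDivisors (X.presheaf.stalk y₀) V :=
    ⟨fun {c v} hcv => by
      rw [stalk_smul_def] at hcv
      rcases smul_eq_zero.mp hcv with h0 | h0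
      · exact Or.inl ((map_eq_zero_iff _ (RatFn.toFunctionField_injective y₀)).mp h0)
      · exact Or.inr h0⟩
  -- a power of the maximal ideal conducts `h` into the lattice
  obtain ⟨k, hk⟩ := exists_pow_maximalIdeal_smul_mem (stalkSpan V S y₀) h fun 𝔮 h𝔮 hne =>
    exists_smul_mem_of_mem_reflexiveHull_of_ne_maximalIdeal hdim 𝔮 hne (stalkSpan V S y₀) hh
  -- an affine chart at `y₀` and generators of the (maximal) prime of `y₀`
  obtain ⟨U, hU, hy₀U⟩ : ∃ U : X.Opens, IsAffineOpen U ∧ y₀ ∈ U := by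
    obtain ⟨_, ⟨U, hU, rfl⟩, hy₀U, -⟩ :=
      X.isBasis_affineOpens.exists_subset_of_mem_open (Set.mem_univ y₀) isOpen_univ
    exact ⟨U, hU, hy₀U⟩
  haveI : IsNoetherianRing Γ(X, U) := IsLocallyNoetherian.component_noetherian ⟨U, hU⟩
  let p₀ := hU.primeIdealOf ⟨y₀, hy₀U⟩
  have hp₀max : p₀.asIdeal.IsMaximal := hU.primeIdealOf_isMaximal_of_isClosed ⟨y₀, hy₀U⟩ hy₀
  letI algy₀ := TopCat.Presheaf.algebra_section_stalk X.presheaf (⟨y₀, hy₀U⟩ : U)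
  haveI hlocy₀ : IsLocalization.AtPrime (X.presheaf.stalk y₀) p₀.asIdeal := hU.isLocalization_stalk ⟨y₀, hy₀U⟩
  obtain ⟨G, hG⟩ := (IsNoetherian.noetherian p₀.asIdeal : p₀.asIdeal.FG)
  -- for each generator `a`, `(germ a)^k • h` lies in the lattices near `y₀`
  have hgen : ∀ a : Γ(X, U), a ∈ p₀.asIdeal →
      ∃ W : X.Opens, y₀ ∈ W ∧ ∀ x' : X, x' ∈ W →
        (evalFn U ⟨y₀, hy₀U⟩ a) ^ k • h ∈ stalkSpan V S x' := by
    intro a ha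
    have hgerm : X.presheaf.germ U y₀ hy₀U a ∈ IsLocalRing.maximalIdeal (X.presheaf.stalk y₀) := by
      have := (IsLocalization.AtPrime.to_map_mem_maximal_iff (X.presheaf.stalk y₀) p₀.asIdeal a).mpr ha
      exact this
    have hmem : (X.presheaf.germ U y₀ hy₀U a) ^ k • h ∈ stalkSpan V S y₀ :=
      hk _ (Ideal.pow_mem_pow hgerm k)
    obtain ⟨W, hy₀W, hW⟩ := exists_opens_forall_mem_stalkSpan V S y₀ hmem
    refine ⟨W, hy₀W, fun x' hx' => ?_⟩
    have heq : ((X.presheaf.germ U y₀ hy₀U a) ^ k • h : V) = (evalFn U ⟨y₀, hy₀U⟩ a) ^ k • h := by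
      rw [stalk_smul_def, map_pow, evalFn_apply]
    rw [← heq]
    exact hW x' hx'
  choose W hy₀W hW using hgen
  have hGp : ∀ a : {a // a ∈ G}, (a : Γ(X, U)) ∈ p₀.asIdeal := fun a => by
    rw [← hG]; exact Ideal.subset_span a.2
  let U₀ : X.Opens :=
    ⟨(U : Set X) ∩ ⋂ a : {a // a ∈ G}, (W a.1 (hGp a) : Set X),
      U.2.inter (isOpen_iInter_of_finite fun a => (W a.1 (hGp a)).2)⟩
  refine ⟨U₀, ⟨hy₀U, Set.mem_iInter.mpr fun a => hy₀W a.1 (hGp a)⟩, fun x hx hne => ?_⟩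
  obtain ⟨hxU, hxW⟩ := hx
  have hxW' : ∀ a : {a // a ∈ G}, x ∈ W a.1 (hGp a) := fun a => Set.mem_iInter.mp hxW a
  -- the prime of `x` in the chart does not contain `p₀`
  let px := hU.primeIdealOf ⟨x, hxU⟩
  have hpx : px ≠ p₀ := by
    intro hpp
    apply hne
    have h1 := hU.fromSpec_primeIdealOf ⟨x, hxU⟩
    have h2 := hU.fromSpec_primeIdealOf ⟨y₀, hy₀U⟩
    change hU.fromSpec px = x at h1
    change hU.fromSpec p₀ = y₀ at h2
    rw [← h1, ← h2, hpp]
  have hnle : ¬ p₀.asIdeal ≤ px.asIdeal := fun hle =>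
    hpx (PrimeSpectrum.ext (hp₀max.eq_of_le px.2.ne_top hle).symm)
  -- so some generator `a ∈ G` of `p₀` is not in `px`
  obtain ⟨a, haG, hapx⟩ : ∃ a ∈ G, a ∉ px.asIdeal := by
    by_contra hall
    push Not at hall
    exact hnle (hG ▸ Ideal.span_le.mpr hall)
  -- `germ_x a` is a unit of `𝒪_{X,x}`
  letI algx := TopCat.Presheaf.algebra_section_stalk X.presheaf (⟨x, hxU⟩ : U)
  haveI hlocx : IsLocalization.AtPrime (X.presheaf.stalk x) px.asIdeal := hU.isLocalization_stalk ⟨x, hxU⟩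
  have hunit : IsUnit (X.presheaf.germ U x hxU a) :=
    (IsLocalization.AtPrime.isUnit_to_map_iff (X.presheaf.stalk x) px.asIdeal a).mpr hapx
  -- `(germ_x a)^k • h = (a|_{K(X)})^k • h` lies in the lattice at `x`
  letI := stalkModule V x
  refine mem_stalkSpan_of_isUnit_smul_mem V S x (hunit.pow k) ?_
  have heq : ((X.presheaf.germ U x hxU a) ^ k • h : V) = (evalFn U ⟨y₀, hy₀U⟩ a) ^ k • h := by
    rw [stalk_smul_def, map_pow, ← evalFn_apply U ⟨x, hxU⟩, evalFn_eq_evalFn U ⟨x, hxU⟩ ⟨y₀, hy₀U⟩]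
  rw [heq]
  exact hW a (hGp ⟨a, haG⟩) x (hxW' ⟨a, haG⟩)

end Summit.ResolutionOfSingularities.ResolutionOfSingularities.Theorems.NoZeno.SandwichCluster.FullSheaf

end
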